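/-
Copyright (c) 2026 the pub-hodgecm-mathlib formalisation cell (harness21).  Prover seat hodgecm-mathlib-K2E3-p17 (g9), Track B «K2-LIT» / h413
(`stmt-HodgeConjecture-24833`), line `K2_E3_EllipticInputs`, leaf (nsc-S-A'), D120 brick IRR''-c2 «Kill», part (K-c): the second peel kernel is zero, and an irreducible
`{X²}`-constituent cannot exist.  2026-09-04.
-/
import Summits.HodgeConjecture.HodgeConjecture.Theorems.K2E3JacquetSubquotientNoCuspidalBool     -- (K-b) (this seat): `eq_zero_of_stagesMap_cyclic_eq_zero`
import Summits.HodgeConjecture.HodgeConjecture.Theorems.K2E3GL3OneLinkNestedHighTower            -- ★ IRR″-c1 (this seat's lineage): `exists_peel_tower`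
import Summits.HodgeConjecture.HodgeConjecture.Theorems.K2E3TwistedCoinvariantsExtension         -- ★ EXT: `forall_mk_whittakerTwist_eq_zero_of_two_step`
import Summits.HodgeConjecture.HodgeConjecture.Theorems.K2E3GL2LinkedStructure                   -- ★ S1b: `mk_whittakerTwist_twist_det_two_eq_zero`
import Summits.HodgeConjecture.HodgeConjecture.Theorems.K2E3GL3DegenerateStagesCriterion         -- ★ S3: `forall_mk_charTwist_eq_zero_iff_whittaker_gl2`
import Summits.HodgeConjecture.HodgeConjecture.Theorems.K2E3GL3DegenerateLevelOneMirror          -- ★ (lev′): `finrank_coinvariants_restrictUnipotentGL_eq_one_of_degenerate'`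
import Summits.HodgeConjecture.HodgeConjecture.Theorems.K2E3DegenerateSubquotientHeredity        -- ★ HER: `forall_mk_charTwist_eq_zero_of_surjective`
import Summits.HodgeConjecture.HodgeConjecture.Theorems.K2E3GL3UnipotentCharacters               -- ★ `exists_character_upperUnitriangular`
import Literature.NumberTheory.Automorphic.MatrixCoefficientsSupercuspidalAdmissibleProofs         -- ★ Schur: `IsIrreducible.exists_eq_smul_id_of_rank_le_aleph0`, `IsSmooth.rank_le_aleph0`
import Literature.NumberTheory.Automorphic.PAdicRepsSupercuspidalProofs                            -- ★ `sigmaCompactSpace_generalLinearGroup`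
import Literature.RepresentationTheory.FiniteGroups.EquivOfCharacter                               -- ★ `Subrepresentation.subtypeIntertwiningMap`, `Subrepresentation.mapSubtype`
import HarnessLib

/-!
# Crux `H413` — leaf (nsc-S-A′), brick IRR″-c2 (K-c): THE SECOND PEEL KERNEL IS ZERO; NO IRREDUCIBLE `{X²}`-CONSTITUENT

Cell `hodgecm-mathlib`, Track B; THEOREMS ONLY; count-neutral helper (`--supports stmt-HodgeConjecture-24833 --as helper`).  Letters as in ★ IRR″-a∕-b∕-c1: `X = tch(a, aν, aν)`,
`a = ην½⁻¹`, `aν = ην½`; `Q = P_{(2,1)}` labelled `![false,false,true]`, `W = (r_Q ω) ∘ ι_e` the `GL₂`-part (★ BRIDGE currency), `p : r_Q ω ↠ r_B ω` ★ p14's stages map.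
* §1 **`peel_kernel_eq_bot`** — for `ω` IRREDUCIBLE smooth, presented as a subquotient of a smooth `I` carrying the cell hypothesis at `c = ![0,0,1]`, and GL₂-subrepresentations
  `K₂ ≤ K₁ ≤ W` with `r_{B₂}(K₂) = 0`: **`K₂ = ⊥`**.  Every vector of `K₂` dies under `p` (left exactness ★ `jacquetGLMap_injective` at `n = 2` + ★ `ker_stagesMap_eq`); by SCHUR on
  the centre of `GL₃(F)` (★ `IsIrreducible.exists_eq_smul_id_of_rank_le_aleph0`; `diag(m) = (t·1₃) · diag(t⁻¹ m)` with `(t⁻¹m)|_{GL₁} = 1`) the image of `K₂` in `r_Q ω` is stable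
  under the WHOLE Levi, so (K-b)'s cyclic «no cuspidal vectors» applies to each of its vectors.
* §2 **`false_of_constituent_X_two`** — an irreducible smooth `ω` with `mult ω X = 2` and no other weight, `ψ`-degenerate (`J_{ψ_nd}(ω) = 0`), presented as a subquotient of such
  an `I`, does not exist: ★ `exists_peel_tower` + §1 give `W = [η∘det, η∘det]`, so `J_ψ(W) = 0` (★ EXT + ★ S1b + ★ HER transport along the peel isomorphisms), hence `ω` is
  `ψ‴`-degenerate (`ψ‴(u) = ψ(u₀₁)`, ★ S3) and ★ (lev′) forces `dim r_B ω = 1 < 2 = mult ω X`.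
Consumer: (K-d) `K2E3GL3OneLinkNestedHighNoPiece` ∕ IRR″ head (and K2E3-p03's IRR‴ head).

HONEST LABEL: HC_CM is proved only modulo the 7 printed citations (2 remaining named inputs: hLiu418 = stmt-HodgeConjecture-24832, h413 =
stmt-HodgeConjecture-24833) until rung 0 closes; count-neutral helper.

## References
* [BernsteinZelevinsky1977] I. N. Bernstein, A. V. Zelevinsky, *Induced representations of reductive p-adic groups I*, Ann. Sci. ÉNS 10 (1977), Prop. 1.9, §2.3–2.4, Thm. 2.5, Thm. 2.9, Thm. 4.7.
* [BernsteinZelevinsky1976] I. N. Bernstein, A. V. Zelevinsky, *Representations of the group GL(n,F) where F is a non-archimedean local field*, Russ. Math. Surveys 31:3 (1976), 2.11 (Schur's lemma).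
* [Zelevinsky1980] A. V. Zelevinsky, *Induced representations of reductive p-adic groups II*, Ann. Sci. ÉNS 13 (1980), §1.6, Ex. 3.2, 4.3.
-/

set_option autoImplicit false
-- the mandated namespace repeats `HodgeConjecture.HodgeConjecture`, as in every `Theorems/*.lean` of this sub-problem
set_option linter.dupNamespace false

noncomputable section

open Module Representation Function Literature.NumberTheory.Automorphic Literature.NumberTheory.Automorphic.Zelevinsky1980
open Literature.NumberTheory.GaloisRepresentations.IsNonarchimedeanLocalField Literature.RepresentationTheory.FiniteGroups Literature.RepresentationTheory.Semisimple
open scoped MatrixGroups NNReal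
open Summit.HodgeConjecture.HodgeConjecture.Cruxes.H413.K2E3JacquetSubquotientNoCuspidalBool (eq_zero_of_stagesMap_cyclic_eq_zero)
open Summit.HodgeConjecture.HodgeConjecture.Cruxes.H413.K2E3GL3OneLinkNestedHighTower (exists_peel_tower)
open Summit.HodgeConjecture.HodgeConjecture.Cruxes.H413.K2E3GL3JacquetInStagesBorel (ker_stagesMap_eq)
open Summit.HodgeConjecture.HodgeConjecture.Cruxes.H413.K2E3GL3ExponentRules (isSmooth_normalizedJacquetGL exists_blockEquiv_twoOne)

namespace Summit.HodgeConjecture.HodgeConjecture.Cruxes.H413.K2E3GL3OneLinkNestedHighKill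

variable {F : Type} [Field F] [ValuativeRel F] [TopologicalSpace F] [IsNonarchimedeanLocalField F]

/-! ## §1 The second peel kernel is zero -/

set_option maxHeartbeats 6400000 in  -- cumulative budget of one long bookkeeping proof over large Jacquet-module terms
/-- **THE PEEL KERNEL VANISHES.**  `ω` irreducible smooth on `GL₃(F)`, a subquotient (`ι₁` injective, `π₁` surjective) of a smooth `I` carrying the cell hypothesis at `c = ![0,0,1]`;
`K₂ ≤ K₁ ≤ W = (r_Q ω) ∘ ι_e` subrepresentations of the `GL₂`-part with `r_{B₂}(K₂) = 0`.  Then `K₂ = ⊥`.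
[cite: BernsteinZelevinsky1977, Prop. 1.9, Thm. 2.5, §2.4, Thm. 2.9] [cite: BernsteinZelevinsky1976, 2.11] -/
theorem peel_kernel_eq_bot
    (e : Fin 2 ≃ {i : Fin 3 // (![false, false, true] : Fin 3 → Bool) i = false})
    (he : ∀ j : Fin 2, ((e j : {i : Fin 3 // (![false, false, true] : Fin 3 → Bool) i = false}) : Fin 3) = Fin.castSucc j)
    {XI X₁ X : Type} [AddCommGroup XI] [Module ℂ XI] [AddCommGroup X₁] [Module ℂ X₁] [AddCommGroup X] [Module ℂ X]
    (I : Representation ℂ (GL (Fin 3) F) XI) (ω₁ : Representation ℂ (GL (Fin 3) F) X₁) (ω : Representation ℂ (GL (Fin 3) F) X) (hI : I.IsSmooth)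
    (hcell : ∀ (W : Type) [AddCommGroup W] [Module ℂ W] (σ : Representation ℂ (Π a, GL {i // (![0, 0, 1] : Fin 3 → Fin 2) i = a} F) W),
      σ.IsIrreducible → σ.IsSmooth → σ.IsSupercuspidal → ∀ (N : Subrepresentation (jacquetGL F (![0, 0, 1] : Fin 3 → Fin 2) I)) (q : N.toRepresentation.IntertwiningMap σ), q = 0)
    (ι₁ : ω₁.IntertwiningMap I) (hι₁ : Function.Injective ι₁) (π₁ : ω₁.IntertwiningMap ω) (hπ₁ : Function.Surjective π₁) [ω.IsIrreducible] (hω : ω.IsSmooth)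
    (K₁ : Subrepresentation ((normalizedJacquetGL F (![false, false, true] : Fin 3 → Bool) ω).comp ((MonoidHom.mulSingle (fun a : Bool => GL {i : Fin 3 // (![false, false, true] : Fin 3 → Bool) i = a} F) false).comp (reindexGL e).toMonoidHom) : Representation ℂ (GL (Fin 2) F) (restrictUnipotentGL F (![false, false, true] : Fin 3 → Bool) ω).Coinvariants)) (K₂ : Subrepresentation K₁.toRepresentation)
    (hK₂ : Subsingleton (restrictUnipotentGL F (lastBlockLabel 2) K₂.toRepresentation).Coinvariants) :
    K₂ = ⊥ := by
  haveI : IsTopologicalRing F := inferInstance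
  -- `W` is smooth
  have hcont : Continuous (((MonoidHom.mulSingle (fun a : Bool => GL {i : Fin 3 // (![false, false, true] : Fin 3 → Bool) i = a} F) false).comp (reindexGL e).toMonoidHom) : GL (Fin 2) F → (Π a : Bool, GL {i : Fin 3 // (![false, false, true] : Fin 3 → Bool) i = a} F)) := (_root_.continuous_mulSingle false).comp (continuous_reindexGL e)
  have hnsm : (normalizedJacquetGL F (![false, false, true] : Fin 3 → Bool) ω).IsSmooth := isSmooth_normalizedJacquetGL (![false, false, true] : Fin 3 → Bool) hω
  have hWsm : Representation.IsSmooth ((normalizedJacquetGL F (![false, false, true] : Fin 3 → Bool) ω).comp ((MonoidHom.mulSingle (fun a : Bool => GL {i : Fin 3 // (![false, false, true] : Fin 3 → Bool) i = a} F) false).comp (reindexGL e).toMonoidHom) : Representation ℂ (GL (Fin 2) F) (restrictUnipotentGL F (![false, false, true] : Fin 3 → Bool) ω).Coinvariants) := IsSmooth.comp_of_continuous _ _ hcont hnsm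
  -- (B) every vector of `K₂` dies under the stages map `p`
  have hpK : ∀ k : ↥K₂.toSubmodule, (Representation.Coinvariants.lift (restrictUnipotentGL F (![false, false, true] : Fin 3 → Bool) ω) (Representation.Coinvariants.mk (restrictUnipotentGL F (id : Fin 3 → Fin 3) ω)) (K2E3GL3JacquetInStagesBorel.mk_comp_restrictUnipotentGL_twoOne_eq ω)) (((k : ↥K₁.toSubmodule) : (restrictUnipotentGL F (![false, false, true] : Fin 3 → Bool) ω).Coinvariants)) = 0 := by
    intro k
    obtain ⟨f, hf⟩ : ∃ f : K₂.toRepresentation.IntertwiningMap ((normalizedJacquetGL F (![false, false, true] : Fin 3 → Bool) ω).comp ((MonoidHom.mulSingle (fun a : Bool => GL {i : Fin 3 // (![false, false, true] : Fin 3 → Bool) i = a} F) false).comp (reindexGL e).toMonoidHom) : Representation ℂ (GL (Fin 2) F) (restrictUnipotentGL F (![false, false, true] : Fin 3 → Bool) ω).Coinvariants), ∀ x, f x = ((x : ↥K₁.toSubmodule) : (restrictUnipotentGL F (![false, false, true] : Fin 3 → Bool) ω).Coinvariants) :=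
      ⟨(Subrepresentation.subtypeIntertwiningMap K₁).comp (Subrepresentation.subtypeIntertwiningMap K₂), fun x => rfl⟩
    have hfinj : Function.Injective f := fun a b hab => by
      rw [hf, hf] at hab
      exact Subtype.ext (Subtype.ext hab)
    have hinj := jacquetGLMap_injective (F := F) (c := (id : Fin 2 → Fin 2)) monotone_id hWsm f hfinj
    -- `[k] = 0` in `r_{U₂}(K₂)` (the `lastBlockLabel 2` and `id` labellings give one kernel)
    have hk0 : (k : ↥K₂.toSubmodule) ∈ Coinvariants.ker (restrictUnipotentGL F (id : Fin 2 → Fin 2) K₂.toRepresentation) := by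
      rw [K2E3GL2JacquetRelabel.coinvariantsKer_restrictUnipotentGL_eq (id : Fin 2 → Fin 2) (lastBlockLabel 2) K2E3GL2JacquetRelabel.unipotentRadicalGL_id_eq_lastBlockLabel_two K₂.toRepresentation]
      exact (Coinvariants.mk_eq_zero _).1 (Subsingleton.elim _ _)
    have h1 : jacquetGLMap F (id : Fin 2 → Fin 2) f (Coinvariants.mk (restrictUnipotentGL F (id : Fin 2 → Fin 2) K₂.toRepresentation) k) =
        Coinvariants.mk (restrictUnipotentGL F (id : Fin 2 → Fin 2) ((normalizedJacquetGL F (![false, false, true] : Fin 3 → Bool) ω).comp ((MonoidHom.mulSingle (fun a : Bool => GL {i : Fin 3 // (![false, false, true] : Fin 3 → Bool) i = a} F) false).comp (reindexGL e).toMonoidHom) : Representation ℂ (GL (Fin 2) F) (restrictUnipotentGL F (![false, false, true] : Fin 3 → Bool) ω).Coinvariants)) (f k) := jacquetGLMap_mk f k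
    have h2 : Coinvariants.mk (restrictUnipotentGL F (id : Fin 2 → Fin 2) ((normalizedJacquetGL F (![false, false, true] : Fin 3 → Bool) ω).comp ((MonoidHom.mulSingle (fun a : Bool => GL {i : Fin 3 // (![false, false, true] : Fin 3 → Bool) i = a} F) false).comp (reindexGL e).toMonoidHom) : Representation ℂ (GL (Fin 2) F) (restrictUnipotentGL F (![false, false, true] : Fin 3 → Bool) ω).Coinvariants)) (f k) = 0 := by
      rw [← h1, (Coinvariants.mk_eq_zero _).2 hk0, map_zero]
    have h3 : f k ∈ Coinvariants.ker (restrictUnipotentGL F (id : Fin 2 → Fin 2) ((normalizedJacquetGL F (![false, false, true] : Fin 3 → Bool) ω).comp ((MonoidHom.mulSingle (fun a : Bool => GL {i : Fin 3 // (![false, false, true] : Fin 3 → Bool) i = a} F) false).comp (reindexGL e).toMonoidHom) : Representation ℂ (GL (Fin 2) F) (restrictUnipotentGL F (![false, false, true] : Fin 3 → Bool) ω).Coinvariants)) := (Coinvariants.mk_eq_zero _).1 h2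
    rw [← ker_stagesMap_eq e he ω, LinearMap.mem_ker, hf] at h3
    exact h3
  -- (C) Schur: the centre of `GL₃(F)` acts on `ω` by scalars
  haveI : SigmaCompactSpace (GL (Fin 3) F) := sigmaCompactSpace_generalLinearGroup F 3
  have hG : ∀ U : Subgroup (GL (Fin 3) F), IsOpen (U : Set (GL (Fin 3) F)) → Countable (GL (Fin 3) F ⧸ U) :=
    fun U hU => countable_quotient_of_isOpen_of_sigmaCompactSpace U hU
  have hZ : ∀ t : Fˣ, ∃ c : ℂ, ω (Matrix.GeneralLinearGroup.scalar (Fin 3) t) = c • (LinearMap.id : X →ₗ[ℂ] X) :=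
    fun t => IsIrreducible.exists_eq_smul_id_of_rank_le_aleph0 (hω.rank_le_aleph0 hG) _ fun h => by
      rw [← Module.End.mul_eq_comp, ← Module.End.mul_eq_comp, ← map_mul, ← map_mul, Matrix.GeneralLinearGroup.scalar_commute]
  -- the block-scalar Levi element `(t·1₂, t·1₁)` has matrix `t·1₃`
  have hscal : ∀ t : Fˣ, blockDiagonalGL F (![false, false, true] : Fin 3 → Bool) (fun a => Matrix.GeneralLinearGroup.scalar _ t) = Matrix.GeneralLinearGroup.scalar (Fin 3) t := by
    intro t
    apply Units.ext
    ext i j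
    simp only [blockDiagonalGL_apply_coe_dite, Matrix.GeneralLinearGroup.coe_scalar, Matrix.scalar_apply, Matrix.diagonal_apply]
    by_cases hij : i = j
    · subst hij
      simp
    · rw [if_neg hij]
      split_ifs with h1 h2
      · exact absurd (congrArg Subtype.val h2) hij
      · rfl
      · rfl
  -- the `GL₁`-block is `1 × 1`
  have hsub : ∀ i : {i : Fin 3 // (![false, false, true] : Fin 3 → Bool) i = true}, i = ⟨2, rfl⟩ := fun i =>
    Subtype.ext (by have hi := i.2; revert hi; generalize (i : Fin 3) = k; intro hk; fin_cases k <;> simp_all)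
  have htrue : ∀ d : GL {i : Fin 3 // (![false, false, true] : Fin 3 → Bool) i = true} F, d = Matrix.GeneralLinearGroup.scalar _ (Matrix.GeneralLinearGroup.det d) := by
    intro d
    apply Units.ext
    ext i j
    obtain rfl := hsub i
    obtain rfl := hsub j
    haveI : Subsingleton {i : Fin 3 // (![false, false, true] : Fin 3 → Bool) i = true} := ⟨fun a b => (hsub a).trans (hsub b).symm⟩
    rw [Matrix.GeneralLinearGroup.coe_scalar, Matrix.scalar_apply, Matrix.diagonal_apply_eq, Matrix.GeneralLinearGroup.val_det_apply,
      Matrix.det_eq_elem_of_subsingleton _ (⟨2, rfl⟩ : {i : Fin 3 // (![false, false, true] : Fin 3 → Bool) i = true})]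
  -- (D) the image of `K₂` in `r_Q ω` is stable under the whole Levi
  have hSW : ∀ (g : GL (Fin 2) F) (x : (restrictUnipotentGL F (![false, false, true] : Fin 3 → Bool) ω).Coinvariants), x ∈ K₂.toSubmodule.map K₁.toSubmodule.subtype → ((normalizedJacquetGL F (![false, false, true] : Fin 3 → Bool) ω).comp ((MonoidHom.mulSingle (fun a : Bool => GL {i : Fin 3 // (![false, false, true] : Fin 3 → Bool) i = a} F) false).comp (reindexGL e).toMonoidHom) : Representation ℂ (GL (Fin 2) F) (restrictUnipotentGL F (![false, false, true] : Fin 3 → Bool) ω).Coinvariants) g x ∈ K₂.toSubmodule.map K₁.toSubmodule.subtype := by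
    rintro g _ ⟨k, hk, rfl⟩
    exact ⟨K₁.toRepresentation g k, K₂.apply_mem_toSubmodule g hk, rfl⟩
  have hSfalse : ∀ (g : GL {i : Fin 3 // (![false, false, true] : Fin 3 → Bool) i = false} F) (x : (restrictUnipotentGL F (![false, false, true] : Fin 3 → Bool) ω).Coinvariants), x ∈ K₂.toSubmodule.map K₁.toSubmodule.subtype →
      jacquetGL F (![false, false, true] : Fin 3 → Bool) ω (Pi.mulSingle (M := (fun a : Bool => GL {i : Fin 3 // (![false, false, true] : Fin 3 → Bool) i = a} F)) false g) x ∈ K₂.toSubmodule.map K₁.toSubmodule.subtype := by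
    intro g x hx
    have hW := hSW ((reindexGL e).symm g) x hx
    have hrew : ((normalizedJacquetGL F (![false, false, true] : Fin 3 → Bool) ω).comp ((MonoidHom.mulSingle (fun a : Bool => GL {i : Fin 3 // (![false, false, true] : Fin 3 → Bool) i = a} F) false).comp (reindexGL e).toMonoidHom) : Representation ℂ (GL (Fin 2) F) (restrictUnipotentGL F (![false, false, true] : Fin 3 → Bool) ω).Coinvariants) ((reindexGL e).symm g) x =
        (((((rootDeltaChar (standardParabolicGL F (![false, false, true] : Fin 3 → Bool)))⁻¹).comp (leviEmbeddingP F (![false, false, true] : Fin 3 → Bool))) (Pi.mulSingle (M := (fun a : Bool => GL {i : Fin 3 // (![false, false, true] : Fin 3 → Bool) i = a} F)) false g) : ℂˣ) : ℂ) •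
          jacquetGL F (![false, false, true] : Fin 3 → Bool) ω (Pi.mulSingle (M := (fun a : Bool => GL {i : Fin 3 // (![false, false, true] : Fin 3 → Bool) i = a} F)) false g) x := by
      change (normalizedJacquetGL F (![false, false, true] : Fin 3 → Bool) ω) (((MonoidHom.mulSingle (fun a : Bool => GL {i : Fin 3 // (![false, false, true] : Fin 3 → Bool) i = a} F) false).comp (reindexGL e).toMonoidHom) ((reindexGL e).symm g)) x = _
      rw [MonoidHom.comp_apply, MulEquiv.coe_toMonoidHom, MulEquiv.apply_symm_apply, MonoidHom.mulSingle_apply]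
      rfl
    rw [hrew] at hW
    have hu : IsUnit (((((rootDeltaChar (standardParabolicGL F (![false, false, true] : Fin 3 → Bool)))⁻¹).comp (leviEmbeddingP F (![false, false, true] : Fin 3 → Bool))) (Pi.mulSingle (M := (fun a : Bool => GL {i : Fin 3 // (![false, false, true] : Fin 3 → Bool) i = a} F)) false g) : ℂˣ) : ℂ) := Units.isUnit _
    exact (Submodule.smul_mem_iff_of_isUnit _ hu).1 hW
  have hScentre : ∀ (t : Fˣ) (x : (restrictUnipotentGL F (![false, false, true] : Fin 3 → Bool) ω).Coinvariants), x ∈ K₂.toSubmodule.map K₁.toSubmodule.subtype →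
      jacquetGL F (![false, false, true] : Fin 3 → Bool) ω (fun a => Matrix.GeneralLinearGroup.scalar _ t) x ∈ K₂.toSubmodule.map K₁.toSubmodule.subtype := by
    intro t x hx
    obtain ⟨c, hc⟩ := hZ t
    obtain ⟨v, rfl⟩ := Coinvariants.mk_surjective _ x
    rw [jacquetGL_mk, hscal, hc, LinearMap.smul_apply, LinearMap.id_apply, map_smul]
    exact Submodule.smul_mem _ c hx
  have hSall : ∀ (m : (Π a : Bool, GL {i : Fin 3 // (![false, false, true] : Fin 3 → Bool) i = a} F)) (x : (restrictUnipotentGL F (![false, false, true] : Fin 3 → Bool) ω).Coinvariants), x ∈ K₂.toSubmodule.map K₁.toSubmodule.subtype →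
      jacquetGL F (![false, false, true] : Fin 3 → Bool) ω m x ∈ K₂.toSubmodule.map K₁.toSubmodule.subtype := by
    intro m x hx
    -- `m = (t·1) · m′` with `m′|_{GL₁} = 1`
    have hm : m = (fun a => Matrix.GeneralLinearGroup.scalar _ (Matrix.GeneralLinearGroup.det (m true))) *
        Pi.mulSingle (M := (fun a : Bool => GL {i : Fin 3 // (![false, false, true] : Fin 3 → Bool) i = a} F)) false
          ((Matrix.GeneralLinearGroup.scalar _ (Matrix.GeneralLinearGroup.det (m true)))⁻¹ * m false) := by
      funext a
      cases a
      · rw [Pi.mul_apply, Pi.mulSingle_eq_same, mul_inv_cancel_left]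
      · rw [Pi.mul_apply, Pi.mulSingle_eq_of_ne (by decide), mul_one]
        exact htrue (m true)
    rw [hm, map_mul, Module.End.mul_apply]
    exact hScentre _ _ (hSfalse _ _ hx)
  obtain ⟨W₂, hW₂⟩ : ∃ W₂ : Subrepresentation (jacquetGL F (![false, false, true] : Fin 3 → Bool) ω), W₂.toSubmodule = K₂.toSubmodule.map K₁.toSubmodule.subtype :=
    ⟨⟨_, fun m x hx => hSall m x hx⟩, rfl⟩
  have hW₂p : ∀ y : (restrictUnipotentGL F (![false, false, true] : Fin 3 → Bool) ω).Coinvariants, y ∈ W₂ → (Representation.Coinvariants.lift (restrictUnipotentGL F (![false, false, true] : Fin 3 → Bool) ω) (Representation.Coinvariants.mk (restrictUnipotentGL F (id : Fin 3 → Fin 3) ω)) (K2E3GL3JacquetInStagesBorel.mk_comp_restrictUnipotentGL_twoOne_eq ω)) y = 0 := by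
    intro y hy
    have hy' : y ∈ W₂.toSubmodule := hy
    rw [hW₂] at hy'
    obtain ⟨k, hk, rfl⟩ := hy'
    exact hpK ⟨k, hk⟩
  -- (E) (K-b), vector by vector
  apply Subrepresentation.toSubmodule_injective
  show K₂.toSubmodule = ⊥
  refine (Submodule.eq_bot_iff _).2 fun k hk => ?_
  have hxW₂ : ((k : ↥K₁.toSubmodule) : (restrictUnipotentGL F (![false, false, true] : Fin 3 → Bool) ω).Coinvariants) ∈ W₂ := by
    show ((k : ↥K₁.toSubmodule) : (restrictUnipotentGL F (![false, false, true] : Fin 3 → Bool) ω).Coinvariants) ∈ W₂.toSubmodule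
    rw [hW₂]
    exact ⟨k, hk, rfl⟩
  have hx0 := eq_zero_of_stagesMap_cyclic_eq_zero e he I ω₁ ω hI hcell ι₁ hι₁ π₁ hπ₁ hω ((k : ↥K₁.toSubmodule) : (restrictUnipotentGL F (![false, false, true] : Fin 3 → Bool) ω).Coinvariants) (fun y hy => by
    apply hW₂p
    rw [Subrepresentation.mem_ofSubmodule'_iff] at hy
    exact Subrepresentation.mem_asSubmodule_iff.1
      ((Submodule.span_le.2 (Set.singleton_subset_iff.2 (Subrepresentation.mem_asSubmodule_iff.2 hxW₂))) hy))
  exact Subtype.ext hx0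

/-! ## §2 No irreducible `{X²}`-constituent -/

set_option maxHeartbeats 6400000 in  -- cumulative budget of the declaration over large Jacquet-module terms
/-- **AN IRREDUCIBLE `{X²}`-CONSTITUENT DOES NOT EXIST.**  `ω` irreducible smooth on `GL₃(F)` with `mult ω X = 2` and no other weight, `ψ`-degenerate, presented as a subquotient
of a smooth `I` carrying the cell hypothesis at `c = ![0,0,1]`: contradiction (`dim r_B ω = 1` by ★ (lev′) after the Kill, versus `mult ω X = 2`).
[cite: BernsteinZelevinsky1977, Thm. 4.7, Thm. 2.9] [cite: Zelevinsky1980, §1.6, Ex. 3.2, 4.3] -/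
theorem false_of_constituent_X_two (η : Fˣ →* ℂˣ) (hη : IsOpen ((η.ker : Subgroup Fˣ) : Set Fˣ))
    {XI X₁ X : Type} [AddCommGroup XI] [Module ℂ XI] [AddCommGroup X₁] [Module ℂ X₁] [AddCommGroup X] [Module ℂ X]
    (I : Representation ℂ (GL (Fin 3) F) XI) (ω₁ : Representation ℂ (GL (Fin 3) F) X₁) (ω : Representation ℂ (GL (Fin 3) F) X) (hI : I.IsSmooth)
    (hcell : ∀ (W : Type) [AddCommGroup W] [Module ℂ W] (σ : Representation ℂ (Π a, GL {i // (![0, 0, 1] : Fin 3 → Fin 2) i = a} F) W),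
      σ.IsIrreducible → σ.IsSmooth → σ.IsSupercuspidal → ∀ (N : Subrepresentation (jacquetGL F (![0, 0, 1] : Fin 3 → Fin 2) I)) (q : N.toRepresentation.IntertwiningMap σ), q = 0)
    (ι₁ : ω₁.IntertwiningMap I) (hι₁ : Function.Injective ι₁) (π₁ : ω₁.IntertwiningMap ω) (hπ₁ : Function.Surjective π₁) [ω.IsIrreducible] (hω : ω.IsSmooth)
    [FiniteDimensional ℂ (restrictUnipotentGL F (id : Fin 3 → Fin 3) ω).Coinvariants]
    (hX : finrank ℂ ↥(⨅ m, Module.End.maxGenEigenspace (Representation.normalizedJacquetGL F (id : Fin 3 → Fin 3) ω m) ((((∏ a : Fin 3, ((![(η * ((unramifiedTwist F (1 / 2) : QuasiChar F).toMonoidHom)⁻¹), (η * ((unramifiedTwist F (1 / 2) : QuasiChar F).toMonoidHom)), (η * ((unramifiedTwist F (1 / 2) : QuasiChar F).toMonoidHom))] : Fin 3 → (Fˣ →* ℂˣ)) a).comp (Matrix.GeneralLinearGroup.det.comp (Pi.evalMonoidHom (fun a : Fin 3 => GL {i : Fin 3 // (id : Fin 3 → Fin 3) i = a} F) a))) m :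 ℂˣ) : ℂ))) = 2)
    (h0 : ∀ ζ : (Π a : Fin 3, GL {i : Fin 3 // (id : Fin 3 → Fin 3) i = a} F) → ℂ, ζ ≠ (fun m : (Π a : Fin 3, GL {i : Fin 3 // (id : Fin 3 → Fin 3) i = a} F) => (((∏ a : Fin 3, ((![(η * ((unramifiedTwist F (1 / 2) : QuasiChar F).toMonoidHom)⁻¹), (η * ((unramifiedTwist F (1 / 2) : QuasiChar F).toMonoidHom)), (η * ((unramifiedTwist F (1 / 2) : QuasiChar F).toMonoidHom))] : Fin 3 → (Fˣ →* ℂˣ)) a).comp (Matrix.GeneralLinearGroup.det.comp (Pi.evalMonoidHom (fun a : Fin 3 => GL {i : Fin 3 // (id : Fin 3 → Fin 3) i = a} F) a))) m : ℂˣ) : ℂ)) → finrank ℂ ↥(⨅ m, Module.End.maxGenEigenspace (Representation.normalizedJacquetGL F (id : Fin 3 → Fin 3) ω m) (ζ m)) = 0)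
    (ψ : AddChar F Circle) (hψ : ψ.IsContinuousNontrivial) (hdeg : ∀ v, Coinvariants.mk (whittakerTwist ω ψ) v = 0) : False := by
  haveI : IsTopologicalRing F := inferInstance
  obtain ⟨e, he⟩ := exists_blockEquiv_twoOne
  obtain ⟨K₁, K₂, ⟨e₁⟩, ⟨e₂⟩, -, hK₂⟩ := exists_peel_tower η hη e he ω hω hX h0
  -- the Kill: `K₂ = ⊥`
  have hbot : K₂ = ⊥ := peel_kernel_eq_bot e he I ω₁ ω hI hcell ι₁ hι₁ π₁ hπ₁ hω K₁ K₂ hK₂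
  -- `J_ψ(W) = 0`: the two layers are `η∘det`, the bottom is `0`
  have hψ0 : ψ ≠ 0 := hψ.2
  have hchar : ∀ z : ℂ, Coinvariants.mk (whittakerTwist ((Representation.trivial ℂ (GL (Fin 2) F) ℂ).twist (η.comp (Matrix.GeneralLinearGroup.det : GL (Fin 2) F →* Fˣ))) ψ) z = 0 :=
    fun z => K2E3GL2LinkedStructure.mk_whittakerTwist_twist_det_two_eq_zero η hψ0 z
  have h₁ : ∀ w, Coinvariants.mk (whittakerTwist K₁.quotientRep ψ) w = 0 :=
    K2E3DegenerateSubquotientHeredity.forall_mk_charTwist_eq_zero_of_surjective e₁.symm.toIntertwiningMap (EquivLike.surjective e₁.symm) hchar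
  have h₁₂ : ∀ w, Coinvariants.mk (whittakerTwist K₂.quotientRep ψ) w = 0 :=
    K2E3DegenerateSubquotientHeredity.forall_mk_charTwist_eq_zero_of_surjective e₂.symm.toIntertwiningMap (EquivLike.surjective e₂.symm) hchar
  have hK₂bot : K₂.toSubmodule = (⊥ : Subrepresentation K₁.toRepresentation).toSubmodule := congrArg Subrepresentation.toSubmodule hbot
  have h₂ : ∀ v, Coinvariants.mk (whittakerTwist K₂.toRepresentation ψ) v = 0 := by
    intro v
    have hv0 : v = 0 := Subtype.ext ((Submodule.mem_bot ℂ).1 ((SetLike.ext_iff.1 hK₂bot (v : ↥K₁.toSubmodule)).1 v.2))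
    rw [hv0, map_zero]
  have hJ : ∀ w, Coinvariants.mk (whittakerTwist ((normalizedJacquetGL F (![false, false, true] : Fin 3 → Bool) ω).comp ((MonoidHom.mulSingle (fun a : Bool => GL {i : Fin 3 // (![false, false, true] : Fin 3 → Bool) i = a} F) false).comp (reindexGL e).toMonoidHom) : Representation ℂ (GL (Fin 2) F) (restrictUnipotentGL F (![false, false, true] : Fin 3 → Bool) ω).Coinvariants) ψ) w = 0 :=
    K2E3TwistedCoinvariantsExtension.forall_mk_whittakerTwist_eq_zero_of_two_step ((normalizedJacquetGL F (![false, false, true] : Fin 3 → Bool) ω).comp ((MonoidHom.mulSingle (fun a : Bool => GL {i : Fin 3 // (![false, false, true] : Fin 3 → Bool) i = a} F) false).comp (reindexGL e).toMonoidHom) : Representation ℂ (GL (Fin 2) F) (restrictUnipotentGL F (![false, false, true] : Fin 3 → Bool) ω).Coinvariants) ψ K₁ K₂ h₂ h₁₂ h₁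
  -- ★ S3: `ω` is `ψ‴`-degenerate, `ψ‴(u) = ψ(u₀₁)`
  obtain ⟨θ₃, hθ₃'⟩ := K2E3GL3UnipotentCharacters.exists_character_upperUnitriangular ψ 1 0
  have hθ₃ : ∀ u : ↥(upperUnitriangular (Fin 3) F), ((θ₃ u : ℂˣ) : ℂ) = ψ (((u : GL (Fin 3) F) : Matrix (Fin 3) (Fin 3) F) 0 1) := fun u => by
    rw [hθ₃', one_mul, zero_mul, add_zero]
  have hdeg3 := (K2E3GL3DegenerateStagesCriterion.forall_mk_charTwist_eq_zero_iff_whittaker_gl2 e he ω θ₃ hθ₃).2 hJ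
  -- ★ (lev′): `dim r_B ω = 1`, but the `X`-weight space has dimension `2`
  have hone := K2E3GL3DegenerateLevelOneMirror.finrank_coinvariants_restrictUnipotentGL_eq_one_of_degenerate' ω hψ hω hdeg θ₃ hθ₃ hdeg3
  have hle := Submodule.finrank_le (⨅ m, Module.End.maxGenEigenspace (Representation.normalizedJacquetGL F (id : Fin 3 → Fin 3) ω m) ((((∏ a : Fin 3, ((![(η * ((unramifiedTwist F (1 / 2) : QuasiChar F).toMonoidHom)⁻¹), (η * ((unramifiedTwist F (1 / 2) : QuasiChar F).toMonoidHom)), (η * ((unramifiedTwist F (1 / 2) : QuasiChar F).toMonoidHom))] : Fin 3 → (Fˣ →* ℂˣ)) a).comp (Matrix.GeneralLinearGroup.det.comp (Pi.evalMonoidHom (fun a : Fin 3 => GL {i : Fin 3 // (id : Fin 3 → Fin 3) i = a} F) a))) m : ℂˣ) : ℂ)))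
  rw [hX, hone] at hle
  omega

end Summit.HodgeConjecture.HodgeConjecture.Cruxes.H413.K2E3GL3OneLinkNestedHighKill

end
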